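import Summits.HodgeConjecture.HodgeConjecture.Theorems.SplitImpliesAllTypeIIAnchorGerm
import Summits.HodgeConjecture.HodgeConjecture.Theorems.SplitImpliesAllNonsplitCellsConnectedOfJ1
import Literature.AlgebraicGeometry.HodgeTheory.AnticommutingEndomorphismMixedClassTopPower
import HarnessLib

/-!
# Route `SplitImpliesAll` — the type-II anchor is met at EVERY polarized type-II member, FACT-FREE
  (staged by vhodge-typer-1 g2 for a prover/planner to land; `--kind proof --supports stmt-HodgeConjecture-19149 --as helper`)

SUPPORT file for item stmt-HodgeConjecture-19149 (`SplitImpliesAll.NonsplitSixfoldCells`, K1). The anchor predicate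
`SplitImpliesAllTypeIIAnchorGerm.antiCompatibleAnchor n d X x` asks for a chart `(A₀, φ₀)` of the marked fibre carrying an
ALGEBRAIC ANTI-COMPATIBLE degree-two class `y` (`φ₀^*y = −d·y`) with `y^{⌣2n} ≠ 0`. So far the tree meets it only at the CM
points `E₀ⁿ × Ē₀ⁿ` of the type-II loci (`Theorems/SplitImpliesAllTypeIIMembers.exists_typeIIMember`, Part A of the P₆ file), and
the words of record for the route read «pointedness at a GENERIC simple type-II member not given — partial handle p429405».
With the Literature lemmas `AnticommutingEndomorphismMixedClass` (p429405: the mixed class `m = (𝟙+ψ)^*h − h − ψ^*h` of an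
endomorphism `ψ` anticommuting with `φ` is algebraic and anti-compatible) and `AnticommutingEndomorphismMixedClassTopPower`
(vhodge-typer-1 g2: `m^{dim A} = c·h^{dim A}`, `c ≠ 0`, for `ψ² = b`, `ψ^*h = b·h`; `= (−4b)ⁿ·h^{2n}`), the anchor is met
ON THE IDENTITY CHART at every polarized TYPE-II MEMBER given by endomorphism data:

  `(A, φ, ψ, h)`: `dim A = 2n`, `φ ≫ φ = −d`, `φ ≫ ψ = −(ψ ≫ φ)`, `ψ ≫ ψ = b` (`b ≥ 1`), `h ∈ N¹H²` with `φ^*h = d·h`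
  (`K`-compatible polarization class, e.g. `h_K(e,a)`), `ψ^*h = b·h` (`ψ` is `h`-symmetric) and `h^{2n} ≠ 0`.

* `antiCompatibleAnchor_of_typeIIMember` — every class of the Weil plane `W_K(A, φ)` of such a member is anchored
  (`antiCompatibleAnchor n d A.X c`), fact-free (`antiCompatibleAnchor_self` + the two Literature files).
* `weilClassesOf_le_algebraicClasses_of_typeIIMember` — hence `W_K(A, φ) ⊆ Nⁿ` at such a member, fact-free (ring 2's
  criterion `weilClassesOf_le_algebraicClasses_of_anticompatible`; in print: the Hodge conjecture for the Weil classes of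
  abelian varieties of type II with `K ⊂ D`, Moonen–Zarhin's second criterion / Murty / Abdulali).
* `nonsplitSixfolds_locus_of_typeIIMember` — the locus hypothesis of ring 2's `nonsplitSixfolds_of_anticompatible`
  (`∃ x ∈ N¹H², φ^*x = −d·x, x⁶ ≠ 0`, «on paper» there) holds at every such sixfold.
* `antiCompatibleAnchor_of_anticomm`, `weilClassesOf_le_algebraicClasses_of_anticomm` — the SYMMETRY HYPOTHESIS DROPPED, in the
  cell's own currency: a member `(A, φ)` polarized by the `K`-symmetrised hyperplane class `h_K(e,a)` (`kSymmClass`, `a ≠ 0`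
  rational — the binder shape of `CellFibre` / `WeilClassesComponent`) that carries an endomorphism `ψ` with `φψ = −ψφ`, `ψ² = b ≥ 1`
  is anchored and its Weil classes are algebraic, fact-free (§5 of the Literature file: symmetrise `h_K` to `b·h_K + ψ^*h_K`;
  `h_K` is algebraic by Lefschetz (1,1), `K`-compatible by `map_kSymmClass_eq_smul`, a real multiple of a Kähler class by
  `exists_isKaehlerClass_ksymm_eq_smul`).

HONEST LABEL. Fact-free typed lemmas at members specified by endomorphism data; no statement that a given cell CONTAINS such a
member beyond the CM points (that is Part A/B, modulo J1), no simplicity/genericity claim, nothing on the germ (L); nothing here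
proves a case of HC beyond the printed type-II one, and `HC_CM`, J1, Markman occur nowhere.

References: [MoonenZarhin1998WeilClasses] §2; [Murty1988] Thm. 2; [vanGeemenVerra2003QuaternionicPryms] Lemma 4.5;
[LangeBirkenhake1992] Lemma 1.1.17, §5.1–5.2; [vanGeemen1994HodgeAV] 4.8, 6.12; [Shimura1963AnalyticFamilies] §4.
-/

set_option linter.dupNamespace false

open CategoryTheory
open Literature.AlgebraicGeometry Literature.AlgebraicGeometry.Motives
open Literature.AlgebraicGeometry.HodgeTheory
open Literature.AlgebraicTopology.SingularHomology
open Literature.AlgebraicGeometry.VanGeemen1994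
open Summit.HodgeConjecture.HodgeConjecture.Ring2.Hypotheses
open Summit.HodgeConjecture.Ring2AbelianAll.NonsplitTypeIIWeilClasses
open Summit.HodgeConjecture.HodgeConjecture.Theorems.SplitImpliesAllTypeIIAnchorGerm
open Summit.HodgeConjecture.HodgeConjecture.Theorems.SplitImpliesAllNonsplitCellsConnectedOfJ1

namespace Summit.HodgeConjecture.HodgeConjecture.Theorems.SplitImpliesAllTypeIIAnchorAtMembers

variable {A : AbelianVariety ℂ} {φ ψ : A ⟶ A} {n d b : ℕ}

/-- **Every polarized type-II member is an anchored fibre on its own chart, FACT-FREE.** For `(A, φ, ψ, h)` as in the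
module docstring, every class `c` of the Weil plane `weilClassesOf A φ n d` satisfies `antiCompatibleAnchor n d A.X c`: the
anchor class is the mixed class `(𝟙+ψ)^*h − h − ψ^*h` (algebraic, anti-compatible, of non-zero top power).
[cite: MoonenZarhin1998WeilClasses, §2] [cite: LangeBirkenhake1992, Lemma 1.1.17 and §5.2] [cite: vanGeemenVerra2003QuaternionicPryms, Lemma 4.5] -/
theorem antiCompatibleAnchor_of_typeIIMember (hA : A.dim = 2 * n) (hφ : φ ≫ φ = -(d • 𝟙 A))
    (hφψ : φ ≫ ψ = -(ψ ≫ φ)) (hψ : ψ ≫ ψ = b • 𝟙 A) (hb : b ≠ 0) {h : complexBetti A.X 2}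
    (halg : h ∈ algebraicClasses A.X 1) (hφh : complexBetti.map φ.hom.hom.hom 2 h = (d : ℂ) • h)
    (hψh : complexBetti.map ψ.hom.hom.hom 2 h = (b : ℂ) • h) (htop : cupPowTwo h (2 * n) ≠ 0)
    {c : complexBetti A.X (2 * n)} (hc : c ∈ weilClassesOf A φ n d) : antiCompatibleAnchor n d A.X c := by
  obtain ⟨y, hyalg, hy, hyt⟩ :=
    exists_antiCompatible_algebraic_topPow_of_anticomm' hA hφψ hψ hb halg hφh hψh htop
  exact antiCompatibleAnchor_self hA hφ hyalg hy hyt hc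

/-- **The Weil classes of a polarized type-II member are algebraic, FACT-FREE** (`n, d ≥ 1`): ring 2's anti-compatible
criterion fed with the mixed class of `ψ`. In print: Moonen–Zarhin's second criterion (type II, `K ⊂ D`).
[cite: MoonenZarhin1998WeilClasses, §2] [cite: Murty1988, Thm. 2] -/
theorem weilClassesOf_le_algebraicClasses_of_typeIIMember (hn : 0 < n) (hd : 0 < d) (hA : A.dim = 2 * n)
    (hφ : φ ≫ φ = -(d • 𝟙 A)) (hφψ : φ ≫ ψ = -(ψ ≫ φ)) (hψ : ψ ≫ ψ = b • 𝟙 A) (hb : b ≠ 0)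
    {h : complexBetti A.X 2} (halg : h ∈ algebraicClasses A.X 1)
    (hφh : complexBetti.map φ.hom.hom.hom 2 h = (d : ℂ) • h) (hψh : complexBetti.map ψ.hom.hom.hom 2 h = (b : ℂ) • h)
    (htop : cupPowTwo h (2 * n) ≠ 0) : weilClassesOf A φ n d ≤ algebraicClasses A.X n := by
  obtain ⟨y, hyalg, hy, hyt⟩ :=
    exists_antiCompatible_algebraic_topPow_of_anticomm' hA hφψ hψ hb halg hφh hψh htop
  exact weilClassesOf_le_algebraicClasses_of_anticompatible hn hd hA hφ hyalg hy hyt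

/-- **The locus hypothesis of ring 2's `nonsplitSixfolds_of_anticompatible` holds at every polarized type-II sixfold**
(`n = 3`): `∃ x ∈ N¹H²(A), φ^*x = −d·x, x⁶ ≠ 0` — there «on paper: x = 2h(β^*·,·), x⁶ = (−4·2)³h⁶», here typed.
[cite: MoonenZarhin1998WeilClasses, §2] [cite: LangeBirkenhake1992, §5.2] -/
theorem nonsplitSixfolds_locus_of_typeIIMember (hA : A.dim = 2 * 3) (hφψ : φ ≫ ψ = -(ψ ≫ φ))
    (hψ : ψ ≫ ψ = b • 𝟙 A) (hb : b ≠ 0) {h : complexBetti A.X 2} (halg : h ∈ algebraicClasses A.X 1)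
    (hφh : complexBetti.map φ.hom.hom.hom 2 h = (d : ℂ) • h) (hψh : complexBetti.map ψ.hom.hom.hom 2 h = (b : ℂ) • h)
    (htop : cupPowTwo h (2 * 3) ≠ 0) :
    ∃ x : complexBetti A.X 2, x ∈ algebraicClasses A.X 1 ∧
      complexBetti.map φ.hom.hom.hom 2 x = -((d : ℂ) • x) ∧ cupPowTwo x (2 * 3) ≠ 0 :=
  exists_antiCompatible_algebraic_topPow_of_anticomm' hA hφψ hψ hb halg hφh hψh htop

/-! ## The symmetry hypothesis dropped: members polarized by `h_K(e,a)` carrying an anticommuting `ψ` with `ψ² = b ≥ 1` -/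

/-- **Every member `(A, φ, h_K(e,a))` of a Weil cell carrying an endomorphism `ψ` with `φψ = −ψφ`, `ψ² = b ≥ 1` is an
anchored fibre on its own chart, FACT-FREE** — no symmetry hypothesis on the polarization (the Literature file symmetrises
`h_K` to `b·h_K + ψ^*h_K`). Inputs: `h_K` is rational and `(1,1)` (a real multiple of a Kähler class,
`exists_isKaehlerClass_ksymm_eq_smul`), hence algebraic (Lefschetz (1,1), `lefschetzOneOne_rational_holds`), and `K`-compatible
(`map_kSymmClass_eq_smul`). [cite: MoonenZarhin1998WeilClasses, §2] [cite: vanGeemen1994HodgeAV, 4.9 and Lemma 5.2 (1)–(2)]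
[cite: VoisinHodgeI2002, §3.1.3 and Thm. 11.30] -/
theorem antiCompatibleAnchor_of_anticomm (hn : 0 < n) (hA : A.dim = 2 * n) (hd : 0 < d) (hφ : φ ≫ φ = -(d • 𝟙 A))
    (hφψ : φ ≫ ψ = -(ψ ≫ φ)) (hψ : ψ ≫ ψ = b • 𝟙 A) (hb : 0 < b) (e : ProjectiveEmbedding A.X)
    {a : complexBetti (projectiveSpace e.n ℂ) 2} (ha : IsRationalClass a) (ha0 : a ≠ 0)
    {c : complexBetti A.X (2 * n)} (hc : c ∈ weilClassesOf A φ n d) : antiCompatibleAnchor n d A.X c := by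
  have hA' : A.dim = (2 * n - 1) + 1 := by omega
  have h2n : 2 * n - 1 + 1 = 2 * n := by omega
  have hX : IsSmoothProjective (2 * n) A.X := isSmoothProjective_of_dim_eq' hA
  obtain ⟨s, H₀, hs, hK, hEq⟩ := exists_isKaehlerClass_ksymm_eq_smul hA' hd φ e ha ha0
  rw [h2n] at hK
  have h11 : IsOfHodgeType (2 * n) A.X 2 1 1 (kSymmClass A φ d e a) := by
    change IsOfHodgeType (2 * n) A.X 2 1 1 ((d : ℂ) • complexBetti.map e.ι 2 a + complexBetti.map φ.hom.hom.hom 2 (complexBetti.map e.ι 2 a))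
    rw [hEq]
    exact hK.isOfHodgeType_one_one.smul _
  have halg : kSymmClass A φ d e a ∈ algebraicClasses A.X 1 :=
    lefschetzOneOne_rational_holds hX _ (isRationalClass_ksymm d φ e ha) h11
  obtain ⟨y, hyalg, hy, hyt⟩ := exists_antiCompatible_algebraic_topPow_of_anticomm_of_kaehler' hA hn hφψ hψ hb halg
    (map_kSymmClass_eq_smul hφ e a) ⟨s, H₀, hs, hK, hEq⟩
  exact antiCompatibleAnchor_self hA hφ hyalg hy hyt hc

/-- **… hence its Weil classes are algebraic, FACT-FREE** (`n, d ≥ 1`): the Hodge conjecture for the Weil plane of every member of a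
Weil cell carrying an indefinite-quaternion endomorphism `ψ` (`φψ = −ψφ`, `ψ² = b ≥ 1`), by ring 2's anti-compatible criterion.
In print: Moonen–Zarhin's second criterion. [cite: MoonenZarhin1998WeilClasses, §2] [cite: Murty1988, Thm. 2] -/
theorem weilClassesOf_le_algebraicClasses_of_anticomm (hn : 0 < n) (hA : A.dim = 2 * n) (hd : 0 < d)
    (hφ : φ ≫ φ = -(d • 𝟙 A)) (hφψ : φ ≫ ψ = -(ψ ≫ φ)) (hψ : ψ ≫ ψ = b • 𝟙 A) (hb : 0 < b)
    (e : ProjectiveEmbedding A.X) {a : complexBetti (projectiveSpace e.n ℂ) 2} (ha : IsRationalClass a) (ha0 : a ≠ 0) :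
    weilClassesOf A φ n d ≤ algebraicClasses A.X n := fun _ hc =>
  algebraicAnchor_of_antiCompatibleAnchor hn hd (antiCompatibleAnchor_of_anticomm hn hA hd hφ hφψ hψ hb e ha ha0 hc)

end Summit.HodgeConjecture.HodgeConjecture.Theorems.SplitImpliesAllTypeIIAnchorAtMembers
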